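import Summits.Ventures.PercRepro.RankLevelSetExplicitLin

/-!
# PercRepro — THE FINITE CELLS OF EVERY LEVEL WITH THE LINEAR-EXPONENT THRESHOLD: `q + 2 ≤ p ≤ 20·q·2^q` (p9, S4)

`proofs/SUBCLAIM-S4-p9.md` §S4.3′. Night-1's «every level is a finite problem modulo the level below»
(`exists_finite_cells_level_succ`, existential `P`, `N`) was made explicit in `RankLevelSetExplicitAll` with THEOREM P's
`Pexp` (`≈ 2^{2^{q−1}}`) and `Nexp p q` (night-1's `core_fixed_rank_of_le`). With THEOREM P⁗′ (`c025_lin_all`,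
`Plin q ≤ 20·q·2^q + 1`) the window in `p` collapses to `q + 2 ≤ p ≤ 20·q·2^q`:

* `finite_cells_level_succ_lin`: C-025 at level `q + 1` (every finite matroid, every `p ≥ q + 3`) follows from level `q`
  together with the simple, coloop-free, `e`-free core cells `(p, n)` with `q + 3 ≤ p < Plin (q + 1)`,
  `n < Nexp p (q + 1)`;
* `c025_level_of_cells_lin`: if every such cell of every level `4 ≤ q′ ≤ q` (`q′ + 2 ≤ p < Plin q′`, `n < Nexp p q′`)
  satisfies C-025 at level `q′`, then level `q` holds for every finite matroid and every `p ≥ q + 2`;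
* `c025_level_of_cells_lin'`: the same with the closed form `p ≤ 20·q′·2^{q′}` in place of `p < Plin q′`.
Nothing here closes a cell; the cells are the GAP of S4 (and of S1–S3 at `q = 4, 5, 6`), stated with explicit bounds.
Axioms: standard.
-/

open scoped Matroid

namespace PercRepro

namespace ThmN

open Set

variable {α : Type}

/-- **Every level is a finite problem modulo the level below, with the linear-exponent threshold**: for `q ≥ 3`,
level `q + 1` for every `p ≥ q + 3` follows from level `q` (all `p ≥ q + 2`) and the simple, coloop-free, `e`-free
core cells of rank `q + 3 ≤ p < Plin (q + 1)` on fewer than `Nexp p (q + 1)` elements. -/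
theorem finite_cells_level_succ_lin (q : ℕ) (hq : 3 ≤ q)
    (hprev : ∀ (M : Matroid α) [M.Finite] (p : ℕ), q + 2 ≤ p → RLS M p q)
    (hcells : ∀ (M : Matroid α) [M.Finite] (p : ℕ), q + 3 ≤ p → p < Plin (q + 1) → M.E.ncard < Nexp p (q + 1) →
      (∀ e ∈ M.E, ∀ f ∈ M.E, e ≠ f → M.eRk {e, f} = 2) → M.eRank = (p : ℕ∞) → (∀ e, ¬ M.IsColoop e) →
      (∀ e ∈ M.E, ∃ A ⊆ M.E \ {e}, e ∉ M.closure A ∧ e ∉ M.closure ((M.E \ {e}) \ A)) → RLS M p (q + 1)) :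
    ∀ (M : Matroid α) [M.Finite] (p : ℕ), q + 3 ≤ p → RLS M p (q + 1) := by
  refine rls_succ_all q hprev ?_
  intro M _ p hp hs hR hc hfree
  rcases Nat.lt_or_ge p (Plin (q + 1)) with hpP | hpP
  · rcases Nat.lt_or_ge M.E.ncard (Nexp p (q + 1)) with hn | hn
    · exact hcells M p hp hpP hn hs hR hc hfree
    · exact core_fixed_rank_of_le p (q + 1) (by omega) M hn hfree
  · exact c025_lin_all (q + 1) (by omega) M p hpP

/-- **THE GAP OF EVERY LEVEL IS AN EXPLICIT FINITE LIST OF CORE CELLS**: if every simple, coloop-free, `e`-free core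
cell `(p, n)` of every level `4 ≤ q′ ≤ q` with `q′ + 2 ≤ p < Plin q′` and `n < Nexp p q′` satisfies C-025 at level
`q′`, then C-025 holds at level `q` for every finite matroid and every `p ≥ q + 2`. -/
theorem c025_level_of_cells_lin (q : ℕ) (hq : 3 ≤ q)
    (hcells : ∀ q', 4 ≤ q' → q' ≤ q → ∀ (M : Matroid α) [M.Finite] (p : ℕ), q' + 2 ≤ p → p < Plin q' →
      M.E.ncard < Nexp p q' → (∀ e ∈ M.E, ∀ f ∈ M.E, e ≠ f → M.eRk {e, f} = 2) → M.eRank = (p : ℕ∞) →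
      (∀ e, ¬ M.IsColoop e) →
      (∀ e ∈ M.E, ∃ A ⊆ M.E \ {e}, e ∉ M.closure A ∧ e ∉ M.closure ((M.E \ {e}) \ A)) → RLS M p q') :
    ∀ (M : Matroid α) [M.Finite] (p : ℕ), q + 2 ≤ p → RLS M p q := by
  induction q, hq using Nat.le_induction with
  | base =>
    intro M _ p hp
    exact SevenThree.c025_three_all M p hp
  | succ q hq ih =>
    have ih' := ih (fun q' h4 hq' => hcells q' h4 (by omega))
    intro M _ p hp
    exact finite_cells_level_succ_lin q hq ih' (hcells (q + 1) (by omega) le_rfl) M p (by omega)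

/-- The same with the closed form `p ≤ 20·q′·2^{q′}` of the window (`Plin q′ ≤ 20·q′·2^{q′} + 1` for `q′ ≥ 4`). -/
theorem c025_level_of_cells_lin' (q : ℕ) (hq : 3 ≤ q)
    (hcells : ∀ q', 4 ≤ q' → q' ≤ q → ∀ (M : Matroid α) [M.Finite] (p : ℕ), q' + 2 ≤ p → p ≤ 20 * q' * 2 ^ q' →
      M.E.ncard < Nexp p q' → (∀ e ∈ M.E, ∀ f ∈ M.E, e ≠ f → M.eRk {e, f} = 2) → M.eRank = (p : ℕ∞) →
      (∀ e, ¬ M.IsColoop e) →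
      (∀ e ∈ M.E, ∃ A ⊆ M.E \ {e}, e ∉ M.closure A ∧ e ∉ M.closure ((M.E \ {e}) \ A)) → RLS M p q') :
    ∀ (M : Matroid α) [M.Finite] (p : ℕ), q + 2 ≤ p → RLS M p q := by
  refine c025_level_of_cells_lin q hq ?_
  intro q' h4 hq' M _ p hp hpP hn hs hR hc hfree
  have hP : Plin q' ≤ Explicit.Tlin q' + 1 := Plin_le_Tlin_succ q' h4
  have hT : Explicit.Tlin q' = 20 * q' * 2 ^ q' := rfl
  exact hcells q' h4 hq' M p hp (by omega) hn hs hR hc hfree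

end ThmN

end PercRepro
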